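import Summits.QuantumFields.YangMills.Theorems.LuscherReductionDressedRitzLiftLeakageAllBasesLift
import HarnessLib

/-!
# Crux `DressedRitz` (stmt-QuantumFields-20205), line «polyakovlift», stub S-LEAK `stub_liftLeakage` — support VIII:
# the TIME-DRESSED press-button (reshape r3: `u_i' = K_β^{m(L)} u_i`), from the RG debt on ONE dressed reference family to the dressed (o4) text

Support module (fleet seat ym-20205-polyakovlift-s1; `--supports stmt-QuantumFields-20205`, helper, no closure claim).  After the one-loop hazard on
the SHARP-TIME lift (evidence #27 `HAZARD-S-LEAK-UV.md`, this seat's F4), the line's (o4) stub is re-keyed to the time-dressed family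
`dressedLiftFamily β φ g = fun i => (transferApply β)^[dressSteps L] (liftVec β φ (g i))`, `dressSteps L = L` (reshape r3, owner word W1; tree defs proposed
in `…PolyakovLiftDressed.lean`).  This file is Part VI (`liftLeakage_of_referenceLaw`) for the dressed family, written over the EXPLICIT iterate with an
arbitrary dressing schedule `m : ℕ → ℕ` (so it elaborates today and specialises to r3 DEFINITIONALLY at `m := dressSteps`):

* `iterate_transferApply_smul`: `K_β^n (a • v) = a • K_β^n v`;
* `iterate_liftVec_eq_smul`: at a raw vacuum `φ = ±Ω` (vacuum package `(Ω, θ)`), `K_β^n (liftVec β φ g) = ⟨φ,Ω⟩ • K_β^n (liftVec β Ω g)`;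
* `leakageClause_iterate_iff`: the dressed (o4) clause at `φ` ⟺ at `Ω` (`⟨φ,Ω⟩² = 1`; twin of ym-infvol-p2's `PolyakovLift.leakageClause_iff`);
* ★★★ `liftLeakage_of_referenceLaw_iterate (m : ℕ → ℕ)`: IF for every `k` there are `C ≥ 0`, `lam0 > 0` such that eventually in the femto window, at the
  Perron–Frobenius vacuum package, the prover exhibits reference one-site data `(Ω₁, ψ, Λ < μ_k(B₁))` at `B₁ = liftCoupling β L` (tree:
  `exists_reference_uniform`), a cluster-constant approximate eigenvalue `a`, rates `2Nρ ≤ C(λ³/L²)λ₀²`, `Nγ ≤ 1/2`, and (RL) ∕ (GR) for the DRESSED reference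
  lifts `K_β^{m(L)}(liftVec β Ω (ψ_n/Ω₁))`, THEN
  `∀ k, ∃ C lam0, … ∀ φ, IsRawVacuum β φ → ∀ ω g, LiftBasis (liftCoupling β L) k ω g → LeakageClause k C β (fun i => K_β^{m(L)} (liftVec β φ (g i)))`
  — the r3 stub text of `stub_liftLeakage` up to unfolding `dressedLiftFamily ∕ dressedLiftVec ∕ dressSteps` (`m := dressSteps`).

HONEST FRAMING: fixed-lattice bookkeeping on the conditional femto rung R2b1; (RL) and (GR) for the dressed family are the OPEN RG estimates of r3
(hard-pair weights damped by `e^{−2m(L)E}`, slow `O(λ)` admixtures reweighted by `O(1)`); the stub stays OPEN; nothing here bears on infinite volume,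
the continuum limit or the Clay gap.  References: M. Lüscher, NPB 219 (1983) 233 [cite: Luscher1983, §3]; Lüscher–Wolff, NPB 339 (1990) 222
[cite: LuscherWolff1990]; Reed–Simon IV Thm XIII.43 [cite: ReedSimonIV1978]; T. Kato (1949) [cite: Kato1949, §1].
-/

set_option autoImplicit false

noncomputable section

open MeasureTheory Filter Topology Real Finset
open Literature.MathematicalPhysics.QuantumFieldTheory (GaugeConfig Site gaugeTransform)
open scoped BigOperators

namespace Summit.QuantumFields.YangMills.Theorems.FemtoTransferGap.LiftLeak

open Summit.QuantumFields.YangMills.Theorems.FemtoTransferGap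
open Summit.QuantumFields.YangMills.Theorems.FemtoTransferGap.PolyakovLift
open Summit.QuantumFields.YangMills.Theorems.FemtoTransferGap.VacDict

variable {L : ℕ} [NeZero L]

/-- Iterates of the transfer operator are homogeneous: `K_β^n (a • v) = a • K_β^n v`. [folklore] -/
theorem iterate_transferApply_smul (β : ℝ) (n : ℕ) (a : ℝ) (v : GaugeConfig 3 L SU2 → ℝ) :
    (transferApply (L := L) β)^[n] (a • v) = a • (transferApply (L := L) β)^[n] v := by
  induction n with
  | zero => rfl
  | succ n ih => rw [Function.iterate_succ_apply', Function.iterate_succ_apply', ih, transferApply_smul]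

section RawVacuum

variable {β θ : ℝ} {Ω : physSubmodule L} {φ : GaugeConfig 3 L SU2 → ℝ}

/-- **Dressed lifts at a raw vacuum are `±` the dressed lifts at `Ω`**: `K_β^n (liftVec β φ g) = ⟨φ,Ω⟩ • K_β^n (liftVec β Ω g)` (`liftVec β φ g =
ins φ (g∘Π_t) = ⟨φ,Ω⟩ • ins Ω (g∘Π_t)` by `PolyakovLift.ins_eq_smul`, then homogeneity of the iterates). [cite: ReedSimonIV1978, Thm XIII.43] -/
theorem iterate_liftVec_eq_smul (hV : IsVacuum β Ω θ) (hφ : IsRawVacuum β φ) (n : ℕ) (g : GaugeConfig 3 1 SU2 → ℝ) :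
    (transferApply (L := L) β)^[n] (liftVec β φ g) =
      l2 φ (Ω : GaugeConfig 3 L SU2 → ℝ) • (transferApply (L := L) β)^[n] (liftVec β (Ω : GaugeConfig 3 L SU2 → ℝ) g) := by
  have h : liftVec β φ g = l2 φ (Ω : GaugeConfig 3 L SU2 → ℝ) • liftVec β (Ω : GaugeConfig 3 L SU2 → ℝ) g :=
    ins_eq_smul hV hφ (flowLiftAt (L := L) 0 (flowTime β L) g)
  rw [h, iterate_transferApply_smul]

/-- **The dressed leakage clause at a raw vacuum ⟺ at `Ω`** (every datum is quadratic in the family and `⟨φ,Ω⟩² = 1`). [folklore] -/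
theorem leakageClause_iterate_iff (hV : IsVacuum β Ω θ) (hφ : IsRawVacuum β φ) (n : ℕ) {k : ℕ} (C : ℝ)
    (g : Fin k → (GaugeConfig 3 1 SU2 → ℝ)) :
    LeakageClause k C β (fun i => (transferApply (L := L) β)^[n] (liftVec β φ (g i))) ↔
      LeakageClause k C β (fun i => (transferApply (L := L) β)^[n] (liftVec β (Ω : GaugeConfig 3 L SU2 → ℝ) (g i))) := by
  obtain ⟨hsq, -⟩ := sq_eq_one_and_eq hV hφ
  have haa : l2 φ (Ω : GaugeConfig 3 L SU2 → ℝ) * l2 φ (Ω : GaugeConfig 3 L SU2 → ℝ) = 1 := by rw [← sq]; exact hsq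
  have h0 : ∀ i, l2 ((transferApply (L := L) β)^[n] (liftVec β φ (g i))) ((transferApply (L := L) β)^[n] (liftVec β φ (g i))) =
      l2 ((transferApply (L := L) β)^[n] (liftVec β (Ω : GaugeConfig 3 L SU2 → ℝ) (g i)))
        ((transferApply (L := L) β)^[n] (liftVec β (Ω : GaugeConfig 3 L SU2 → ℝ) (g i))) := fun i => by
    rw [iterate_liftVec_eq_smul hV hφ, OpPlat.l2_smul_smul, haa, one_mul]
  have h1 : ∀ i, l2 ((transferApply (L := L) β)^[n] (liftVec β φ (g i))) (transferApply β ((transferApply (L := L) β)^[n] (liftVec β φ (g i)))) =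
      l2 ((transferApply (L := L) β)^[n] (liftVec β (Ω : GaugeConfig 3 L SU2 → ℝ) (g i)))
        (transferApply β ((transferApply (L := L) β)^[n] (liftVec β (Ω : GaugeConfig 3 L SU2 → ℝ) (g i)))) := fun i => by
    rw [iterate_liftVec_eq_smul hV hφ, transferApply_smul, OpPlat.l2_smul_smul, haa, one_mul]
  have h2 : ∀ i, l2 (transferApply β ((transferApply (L := L) β)^[n] (liftVec β φ (g i))))
        (transferApply β ((transferApply (L := L) β)^[n] (liftVec β φ (g i)))) =
      l2 (transferApply β ((transferApply (L := L) β)^[n] (liftVec β (Ω : GaugeConfig 3 L SU2 → ℝ) (g i))))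
        (transferApply β ((transferApply (L := L) β)^[n] (liftVec β (Ω : GaugeConfig 3 L SU2 → ℝ) (g i)))) := fun i => by
    rw [iterate_liftVec_eq_smul hV hφ, transferApply_smul, OpPlat.l2_smul_smul, haa, one_mul]
  unfold LeakageClause
  simp only [h0, h1, h2]

end RawVacuum

/-- ★★★ **S-LEAK (TIME-DRESSED, reshape r3 shape) from the RG debt on ONE dressed reference family per lattice point.**  Dressing schedule
`m : ℕ → ℕ` (r3: `m = dressSteps = id`).  Hypothesis: for every `k`, constants `C ≥ 0`, `lam0 > 0` such that eventually in the femto window, at the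
Perron–Frobenius vacuum package `(Ω, θ)` (`Ω ≥ c > 0`), the prover exhibits reference one-site data at `B₁ = liftCoupling β L` (positive raw vacuum `Ω₁`,
exact orthonormal eigenfamily `ψ_0 … ψ_{N−1}`, levels `λ_n`, domination at `0 ≤ Λ < μ_k(B₁)`), a cluster-constant approximate eigenvalue `a`, rates
`ρ, γ ≥ 0` with `2Nρ ≤ C(λ³/L²)λ₀²`, `Nγ ≤ 1/2`, and for the DRESSED reference lifts `v_n = K_β^{m(L)}(liftVec β Ω (ψ_n/Ω₁))`: (RL)
`‖K_βv_n − a(λ_n)·v_n‖² ≤ ρ‖v_n‖²`, (GR) `|⟨v_n,v_{n'}⟩| ≤ γ‖v_n‖‖v_{n'}‖` (`n ≠ n'`, `λ_n = λ_{n'}`).  Conclusion: the dressed (o4) stub text for EVERY raw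
vacuum and EVERY lift basis (= r3's `Stmt.stub_liftLeakage` after unfolding `dressedLiftFamily`, at `m := dressSteps`).
[cite: Luscher1983, §3] [cite: LuscherWolff1990] [cite: Kato1949, §1] [cite: ReedSimonIV1978, Thm XIII.1] -/
theorem liftLeakage_of_referenceLaw_iterate (m : ℕ → ℕ)
    (h : ∀ k : ℕ, ∃ C lam0 : ℝ, 0 ≤ C ∧ 0 < lam0 ∧ ∀ lam : ℝ, 0 < lam → lam ≤ lam0 → ∃ L0 : ℕ,
      ∀ (L : ℕ) [NeZero L], L0 ≤ L → ∀ β : ℝ, InFemtoWindow lam β L →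
        ∀ (Ω : physSubmodule L) (θ c : ℝ), IsVacuum β Ω θ → 0 < c → (∀ U, c ≤ (Ω : GaugeConfig 3 L SU2 → ℝ) U) →
          ∃ (Ω₁ : GaugeConfig 3 1 SU2 → ℝ) (N : ℕ) (ψ : Fin N → (GaugeConfig 3 1 SU2 → ℝ)) (ev : Fin N → ℝ) (Λ : ℝ)
            (a : ℝ → ℝ) (ρ γ : ℝ),
            IsRawVacuum (liftCoupling β L) Ω₁ ∧ (∃ c₁ : ℝ, 0 < c₁ ∧ ∀ V, c₁ ≤ Ω₁ V) ∧ (∀ n, IsPhys (ψ n)) ∧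
            (∀ n n', l2 (ψ n) (ψ n') = if n = n' then 1 else 0) ∧ (∀ n, transferApply (liftCoupling β L) (ψ n) = ev n • ψ n) ∧
            0 ≤ Λ ∧ Λ < levelValue su2Rep 1 (liftCoupling β L) k ∧
            (∀ χ : GaugeConfig 3 1 SU2 → ℝ, IsPhys χ → (∀ n, l2 χ (ψ n) = 0) →
              l2 χ (transferApply (liftCoupling β L) χ) ≤ Λ * l2 χ χ) ∧
            0 ≤ ρ ∧ 0 ≤ γ ∧ (N : ℝ) * γ ≤ 1 / 2 ∧
            2 * N * ρ ≤ C * (luscherLambda β L ^ 3 / (L : ℝ) ^ 2) * levelValue su2Rep L β 0 ^ 2 ∧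
            (∀ n, l2 (transferApply β ((transferApply (L := L) β)^[m L] (liftVec β (Ω : GaugeConfig 3 L SU2 → ℝ) (ψ n / Ω₁))) -
                    a (ev n) • (transferApply (L := L) β)^[m L] (liftVec β (Ω : GaugeConfig 3 L SU2 → ℝ) (ψ n / Ω₁)))
                  (transferApply β ((transferApply (L := L) β)^[m L] (liftVec β (Ω : GaugeConfig 3 L SU2 → ℝ) (ψ n / Ω₁))) -
                    a (ev n) • (transferApply (L := L) β)^[m L] (liftVec β (Ω : GaugeConfig 3 L SU2 → ℝ) (ψ n / Ω₁))) ≤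
                ρ * l2 ((transferApply (L := L) β)^[m L] (liftVec β (Ω : GaugeConfig 3 L SU2 → ℝ) (ψ n / Ω₁)))
                  ((transferApply (L := L) β)^[m L] (liftVec β (Ω : GaugeConfig 3 L SU2 → ℝ) (ψ n / Ω₁)))) ∧
            (∀ n n', n ≠ n' → ev n = ev n' →
              |l2 ((transferApply (L := L) β)^[m L] (liftVec β (Ω : GaugeConfig 3 L SU2 → ℝ) (ψ n / Ω₁)))
                  ((transferApply (L := L) β)^[m L] (liftVec β (Ω : GaugeConfig 3 L SU2 → ℝ) (ψ n' / Ω₁)))| ≤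
                γ * (Real.sqrt (l2 ((transferApply (L := L) β)^[m L] (liftVec β (Ω : GaugeConfig 3 L SU2 → ℝ) (ψ n / Ω₁)))
                    ((transferApply (L := L) β)^[m L] (liftVec β (Ω : GaugeConfig 3 L SU2 → ℝ) (ψ n / Ω₁)))) *
                  Real.sqrt (l2 ((transferApply (L := L) β)^[m L] (liftVec β (Ω : GaugeConfig 3 L SU2 → ℝ) (ψ n' / Ω₁)))
                    ((transferApply (L := L) β)^[m L] (liftVec β (Ω : GaugeConfig 3 L SU2 → ℝ) (ψ n' / Ω₁))))))) :
    ∀ k : ℕ, ∃ C lam0 : ℝ, 0 ≤ C ∧ 0 < lam0 ∧ ∀ lam : ℝ, 0 < lam → lam ≤ lam0 → ∃ L0 : ℕ,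
      ∀ (L : ℕ) [NeZero L], L0 ≤ L → ∀ β : ℝ, InFemtoWindow lam β L →
        ∀ φ : GaugeConfig 3 L SU2 → ℝ, IsRawVacuum β φ →
          ∀ (ω : GaugeConfig 3 1 SU2 → ℝ) (g : Fin k → (GaugeConfig 3 1 SU2 → ℝ)), LiftBasis (liftCoupling β L) k ω g →
            LeakageClause k C β (fun i => (transferApply (L := L) β)^[m L] (liftVec β φ (g i))) := by
  intro k
  obtain ⟨C, lam0, hC, hlam0, hk⟩ := h k
  refine ⟨C, lam0, hC, hlam0, fun lam hlam hle => ?_⟩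
  obtain ⟨L0, hL⟩ := hk lam hlam hle
  refine ⟨L0, fun L _ hL0 β hW φ hφ ω g hb => ?_⟩
  obtain ⟨Ω, θ, c, hV, hc, hcle⟩ := exists_isVacuum (L := L) β
  obtain ⟨Ω₁, N, ψ, ev, Λ, a, ρ, γ, hΩ₁, hpos, hψ, hon, heig, hΛ, hΛk, hdom, hρ, hγ, hNγ, hNρ, hres, hgram⟩ :=
    hL L hL0 β hW Ω θ c hV hc hcle
  have hB : 0 < liftCoupling β L := by
    unfold liftCoupling
    exact div_pos two_pos (pow_pos (luscherLambda_pos_of_window hlam hW) 3)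
  have hΩphys : IsPhys (Ω : GaugeConfig 3 L SU2 → ℝ) := hV.raw.1
  have hres_all : ∀ i : Fin k, ∃ a' : ℝ,
      l2 (transferApply β ((transferApply (L := L) β)^[m L] (liftVec β (Ω : GaugeConfig 3 L SU2 → ℝ) (g i))) -
            a' • (transferApply (L := L) β)^[m L] (liftVec β (Ω : GaugeConfig 3 L SU2 → ℝ) (g i)))
          (transferApply β ((transferApply (L := L) β)^[m L] (liftVec β (Ω : GaugeConfig 3 L SU2 → ℝ) (g i))) -
            a' • (transferApply (L := L) β)^[m L] (liftVec β (Ω : GaugeConfig 3 L SU2 → ℝ) (g i))) ≤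
        C * (luscherLambda β L ^ 3 / (L : ℝ) ^ 2) * levelValue su2Rep L β 0 ^ 2 *
          l2 ((transferApply (L := L) β)^[m L] (liftVec β (Ω : GaugeConfig 3 L SU2 → ℝ) (g i)))
            ((transferApply (L := L) β)^[m L] (liftVec β (Ω : GaugeConfig 3 L SU2 → ℝ) (g i))) := by
    intro i
    obtain ⟨a', ha'⟩ := residualLaw_allBases_of_reference_iterate β (m L) hΩphys hB k hΩ₁ hpos hψ hon ev heig hΛ hΛk hdom a hρ hγ hNγ
      hres hgram hb i
    exact ⟨a', ha'.trans (mul_le_mul_of_nonneg_right hNρ (l2_self_nonneg _))⟩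
  have hΩclause : LeakageClause k C β (fun i => (transferApply (L := L) β)^[m L] (liftVec β (Ω : GaugeConfig 3 L SU2 → ℝ) (g i))) :=
    leakageClause_of_residual C β (fun i => isPhys_iterate_liftVec β (m L) hΩphys (hb.2.2.2.2.1 i)) hres_all
  exact (leakageClause_iterate_iff hV hφ (m L) C g).2 hΩclause

end Summit.QuantumFields.YangMills.Theorems.FemtoTransferGap.LiftLeak

end
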